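import Summits.QuantumAdvantage.AdviceFreeQNC0.OddPrimeStatements
import HarnessLib

/-!
# Cell qa-qnc0 (odd primes): `ChargeRecursion` — the u-walk game's renewal structure under peeling the first bit

Planner qa-qnc0-p2 g13, ROUND-13 §3♯♯ / `line13/Sketch13p2.lean` §7 (statement `ChargeRecursion` VERBATIM; "support, S; the
walk's renewal structure, for inductive arguments").  PROVED here:

* **`chargeRecursion : ChargeRecursion`** — peeling the first bit `b = u₀`: cut `0` contributes the test
  `[c + b + |u'| ≢ 0 (mod 3)]`, while the cuts `g ≥ 1` form the `n`-bit game at the SHIFTED charge `c + 1 + 2b` played by the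
  restricted strategy `y' h v = y (h+1) (b :: v)` (since `walkExp (b :: u') (h+1) = 2b + walkExp u' h`):
  `ringWinU c y (b :: u') = ([y 0 (b :: u')] ∧ [c + b + |u'| ≢ 0]) ⊕ ringWinU (c + 1 + 2b) y' u'`.

WHAT THIS IS NOT: an identity only; whether `2/3` is the fixed point of an induction on `n` over low-degree strategies is the open
sub-question of ROUND-13 §3♯♯; separation NOT moved.
-/

namespace Summit.QuantumAdvantage.AdviceFreeQNC0

open Classical
open Finset

/-! ### Statement (planner qa-qnc0-p2 Sketch13p2 §7, verbatim) -/

/-- `ChargeRecursion` (support, S): the win indicator on `n+1` bits splits as (cut-0 test at charge `c+b`) XOR (the `n`-bit game at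
charge `c + 1 + 2b` played by the restricted strategy). (Sketch13p2 §7, verbatim.) PROVED: `chargeRecursion`. -/
def ChargeRecursion : Prop :=
  ∀ (n c : ℕ) (y : Fin (n + 2) → (Fin (n + 1) → Bool) → Bool) (b : Bool) (u' : Fin n → Bool),
    ringWinU c y (Fin.cons b u') =
      xor (y 0 (Fin.cons b u') && decide ((c + b.toNat + wt u') % 3 ≠ 0))
          (ringWinU (c + 1 + 2 * b.toNat) (fun h v => y h.succ (Fin.cons b v)) u')

/-! ### Weights under `Fin.cons` -/

variable {n : ℕ}

/-- A count over `Fin (n+1)` splits into the head and a count over `Fin n`. -/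
private theorem card_filter_fin_succ (P : Fin (n + 1) → Prop) [DecidablePred P] :
    (univ.filter P).card = (if P 0 then 1 else 0) + (univ.filter fun j : Fin n => P j.succ).card := by
  rw [Finset.card_filter, Fin.sum_univ_succ, Finset.card_filter]

/-- `wt (b :: u') = b + wt u'`. -/
theorem wt_cons (b : Bool) (u' : Fin n → Bool) : wt (Fin.cons b u' : Fin (n + 1) → Bool) = b.toNat + wt u' := by
  unfold wt
  rw [card_filter_fin_succ]
  simp only [Fin.cons_zero, Fin.cons_succ]
  cases b <;> simp

/-- `wtPrefix (b :: u') (h+1) = b + wtPrefix u' h`. -/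
theorem wtPrefix_cons_succ (b : Bool) (u' : Fin n → Bool) (h : ℕ) :
    wtPrefix (Fin.cons b u' : Fin (n + 1) → Bool) (h + 1) = b.toNat + wtPrefix u' h := by
  unfold wtPrefix
  rw [card_filter_fin_succ]
  simp only [Fin.cons_zero, Fin.cons_succ, Fin.val_zero, Nat.zero_lt_succ, true_and, Fin.val_succ,
    Nat.succ_lt_succ_iff]
  cases b <;> simp

/-- `wtPrefix u 0 = 0`. -/
theorem wtPrefix_zero' (u : Fin (n + 1) → Bool) : wtPrefix u 0 = 0 := by
  unfold wtPrefix
  rw [Finset.card_eq_zero]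
  ext i; simp

/-- `walkExp (b :: u') (h+1) = 2b + walkExp u' h`. -/
theorem walkExp_cons_succ (b : Bool) (u' : Fin n → Bool) (h : ℕ) :
    walkExp (Fin.cons b u' : Fin (n + 1) → Bool) (h + 1) = 2 * b.toNat + walkExp u' h := by
  unfold walkExp
  rw [wt_cons, wtPrefix_cons_succ]
  ring

/-- `walkExp (b :: u') 0 = b + wt u'`. -/
theorem walkExp_cons_zero (b : Bool) (u' : Fin n → Bool) :
    walkExp (Fin.cons b u' : Fin (n + 1) → Bool) 0 = b.toNat + wt u' := by
  unfold walkExp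
  rw [wt_cons, wtPrefix_zero', add_zero]

/-! ### The recursion -/

/-- Parity bookkeeping: `(a + m) % 2 = 1 ↔ a ⊕ (m % 2 = 1)` for `a ∈ {0,1}`. -/
private theorem decide_add_mod_two (P : Prop) [Decidable P] (m : ℕ) :
    decide (((if P then 1 else 0) + m) % 2 = 1) = xor (decide P) (decide (m % 2 = 1)) := by
  by_cases hP : P
  · rw [if_pos hP, decide_eq_true hP]
    rcases Nat.mod_two_eq_zero_or_one m with h | h
    · have h1 : (1 + m) % 2 = 1 := by omega
      simp [h1, h]
    · have h1 : ¬ (1 + m) % 2 = 1 := by omega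
      simp [h1, h]
  · rw [if_neg hP, zero_add]
    simp [hP]

/-- **`ChargeRecursion` — PROVED.** -/
theorem chargeRecursion : ChargeRecursion := by
  intro n c y b u'
  -- the cut-`0` test and the shifted game
  have hsplit := card_filter_fin_succ (fun g : Fin (n + 2) =>
    y g (Fin.cons b u') = true ∧ (c + g.val + walkExp (Fin.cons b u' : Fin (n + 1) → Bool) g.val) % 3 ≠ 0)
  have h0 : (y 0 (Fin.cons b u') = true ∧
      (c + (0 : Fin (n + 2)).val + walkExp (Fin.cons b u' : Fin (n + 1) → Bool) (0 : Fin (n + 2)).val) % 3 ≠ 0) ↔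
      (y 0 (Fin.cons b u') && decide ((c + b.toNat + wt u') % 3 ≠ 0)) = true := by
    rw [Fin.val_zero, walkExp_cons_zero, Bool.and_eq_true, decide_eq_true_eq]
    constructor
    · rintro ⟨h1, h2⟩; exact ⟨h1, by omega⟩
    · rintro ⟨h1, h2⟩; exact ⟨h1, by omega⟩
  have hrest : (univ.filter fun j : Fin (n + 1) =>
      y j.succ (Fin.cons b u') = true ∧
        (c + (j.succ).val + walkExp (Fin.cons b u' : Fin (n + 1) → Bool) (j.succ).val) % 3 ≠ 0) =
      univ.filter fun h : Fin (n + 1) =>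
        (fun h v => y h.succ (Fin.cons b v)) h u' = true ∧ (c + 1 + 2 * b.toNat + h.val + walkExp u' h.val) % 3 ≠ 0 := by
    refine Finset.filter_congr fun j _ => ?_
    rw [Fin.val_succ, walkExp_cons_succ]
    constructor
    · rintro ⟨h1, h2⟩; exact ⟨h1, by omega⟩
    · rintro ⟨h1, h2⟩; exact ⟨h1, by omega⟩
  unfold ringWinU
  rw [hsplit, hrest]
  rw [decide_add_mod_two]
  congr 1
  rw [Bool.decide_congr h0]
  cases (y 0 (Fin.cons b u') && decide ((c + b.toNat + wt u') % 3 ≠ 0)) <;> simp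

end Summit.QuantumAdvantage.AdviceFreeQNC0
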